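import Literature.Algebra.Homology.OrderedCechShuffleCoefficient
import HarnessLib

/-!
# The shuffle coefficient on sets containing the last column: only the staircase survives (Eilenberg–Mac Lane 1953 §5)

Layer `Literature/Algebra/Homology`, PROOF lane (theorems only; no definition, no instance, no notation, no named fact; pure finite
combinatorics).  Sequel to `Algebra/Homology/OrderedCechShuffleCoefficient` (`shuffleCoeff s t T ∈ ℤ`, the signed indicator of the lattice
paths in `s × t`).  The composite «cross product, then shuffle map» of the Eilenberg–Zilber pair evaluates a cochain only along sets `T`
that contain the whole LAST COLUMN `{max s} × t`; this file computes the shuffle coefficient on such sets: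

* `shuffleCoeff_singleton_right` — one row: `m(s, {j}, T) = [T = s × {j}]`;
* `shuffleCoeff_of_column` — if `{max s} × t ⊆ T` and `#t ≥ 2`, the horizontal branch of the last-vertex recursion dies:
  `m(s, t, T) = m(s, t ∖ max t, T ∖ (max s, max t))`;
* **`shuffleCoeff_eq_ite_of_column`** — if `{max s} × t ⊆ T` then `m(s, t, T) = [T = (s × {min t}) ∪ ({max s} × t)]`: the only surviving
  set is the STAIRCASE «first along `s` at height `min t`, then up the last column», with coefficient `+1` (it sweeps no cell).

Cell `hodgecm-mathlib` (D-0151), F-11 / J3 Künneth packet, brick (K2-c-3) of F0P1b-p04's plan (`× ≫ ∇ = 𝟙`).  HC_CM is proved only modulo the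
7 printed citations until rung 0 closes — nothing here bears on a summit statement.

## References
* S. Eilenberg, S. Mac Lane, *On the groups `H(Π,n)`, I*, Ann. of Math. 58 (1953), §5. [EilenbergMacLane1953]
* The Stacks Project, Tag 0BEC. [StacksProject]
-/

namespace Literature.Algebra.Homology

namespace OrderedCech

variable {ι κ : Type} [LinearOrder ι] [LinearOrder κ]

/-! ### §1 Membership in a row, in the staircase -/

/-- `w ∈ s × {j} ↔ w.1 ∈ s ∧ w.2 = j`. [cite: StacksProject, Tag 0BEC] -/
theorem mem_image_toLex_singleton {s : Finset ι} {j : κ} {w : ι ×ₗ κ} :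
    w ∈ (s ×ˢ ({j} : Finset κ)).image toLex ↔ (ofLex w).1 ∈ s ∧ (ofLex w).2 = j := by
  rw [mem_image_toLex, Finset.mem_singleton]

/-- Membership in the staircase `(s × {j₀}) ∪ ({i₁} × t)`. [cite: EilenbergMacLane1953, §5] -/
theorem mem_staircase {s : Finset ι} {t : Finset κ} {i₁ : ι} {j₀ : κ} {w : ι ×ₗ κ} :
    w ∈ ((s ×ˢ ({j₀} : Finset κ)) ∪ (({i₁} : Finset ι) ×ˢ t)).image toLex ↔
      ((ofLex w).1 ∈ s ∧ (ofLex w).2 = j₀) ∨ ((ofLex w).1 = i₁ ∧ (ofLex w).2 ∈ t) := by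
  rw [Finset.image_union, Finset.mem_union, mem_image_toLex_singleton, mem_image_toLex, Finset.mem_singleton]

/-- A row through the maximum of `s`: `s × {j} = (max s, j) ∪ (s ∖ max s) × {j}`. [cite: StacksProject, Tag 0BEC] -/
theorem image_toLex_singleton_eq_insert {s : Finset ι} (hs : s.Nonempty) (j : κ) :
    (s ×ˢ ({j} : Finset κ)).image toLex =
      insert (toLex (s.max' hs, j)) (((s.erase (s.max' hs)) ×ˢ ({j} : Finset κ)).image toLex) := by
  ext w
  rw [Finset.mem_insert, mem_image_toLex_singleton, mem_image_toLex_singleton, Finset.mem_erase]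
  constructor
  · rintro ⟨h1, h2⟩
    by_cases h : (ofLex w).1 = s.max' hs
    · left
      apply ofLex.injective
      exact Prod.ext h h2
    · exact Or.inr ⟨⟨h, h1⟩, h2⟩
  · rintro (rfl | ⟨⟨-, h1⟩, h2⟩)
    · exact ⟨s.max'_mem hs, rfl⟩
    · exact ⟨h1, h2⟩

/-- The last vertex of a row is not in the shorter row. [cite: StacksProject, Tag 0BEC] -/
theorem toLex_max'_not_mem_image_erase {s : Finset ι} (hs : s.Nonempty) (j : κ) :
    toLex (s.max' hs, j) ∉ ((s.erase (s.max' hs)) ×ˢ ({j} : Finset κ)).image toLex := by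
  rw [mem_image_toLex_singleton]
  rintro ⟨h, -⟩
  exact Finset.notMem_erase _ _ h

/-! ### §2 One row -/

/-- **One row**: `m(s, {j}, T) = [T = s × {j}]` (the unique path is the whole row; it sweeps no cell). [cite: EilenbergMacLane1953, §5] -/
theorem shuffleCoeff_singleton_right {s : Finset ι} (hs : s.Nonempty) (j : κ) (T : Finset (ι ×ₗ κ)) :
    shuffleCoeff s {j} T = if T = (s ×ˢ ({j} : Finset κ)).image toLex then 1 else 0 := by
  induction hn : s.card using Nat.strong_induction_on generalizing s T with
  | _ n ih =>
  have ht : ({j} : Finset κ).Nonempty := Finset.singleton_nonempty j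
  have hmax : ({j} : Finset κ).max' ht = j := Finset.max'_singleton j
  by_cases hw : toLex (s.max' hs, j) ∈ T
  swap
  · -- the last vertex is missing: both sides vanish
    rw [shuffleCoeff_eq_zero_of_max_not_mem hs ht (by rwa [hmax]), if_neg]
    rintro rfl
    exact hw (mem_image_toLex_singleton.mpr ⟨s.max'_mem hs, rfl⟩)
  rw [shuffleCoeff_unfold hs ht (by rwa [hmax])]
  simp only [hmax, Finset.card_singleton, Nat.sub_self, pow_zero, one_mul, Finset.erase_singleton,
    shuffleCoeff_of_not_nonempty_right _ Finset.not_nonempty_empty, add_zero]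
  by_cases h1 : s.card = 1
  · -- `s = {max s}`
    have hs' : ¬ (s.erase (s.max' hs)).Nonempty := by
      rw [Finset.not_nonempty_iff_eq_empty, ← Finset.card_eq_zero]
      have := Finset.card_erase_add_one (s.max'_mem hs); omega
    rw [shuffleCoeff_of_not_nonempty_left hs', zero_add]
    have he : (s ×ˢ ({j} : Finset κ)).image toLex = {toLex (s.max' hs, j)} := by
      rw [image_toLex_singleton_eq_insert hs, Finset.not_nonempty_iff_eq_empty.mp hs', Finset.empty_product,
        Finset.image_empty, Finset.insert_empty]
    rw [he]
    by_cases hT : T = {toLex (s.max' hs, j)}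
    · rw [if_pos ⟨h1, trivial, hT⟩, if_pos hT]
    · rw [if_neg (fun h => hT h.2.2), if_neg hT]
  · -- `#s ≥ 2`: induction on the shorter row
    have hs' : (s.erase (s.max' hs)).Nonempty := by
      rw [← Finset.card_pos]
      have := Finset.card_erase_add_one (s.max'_mem hs); have := hs.card_pos; omega
    have hlt : (s.erase (s.max' hs)).card < n := by
      have := Finset.card_erase_lt_of_mem (s.max'_mem hs); omega
    rw [ih _ hlt hs' _ rfl, image_toLex_singleton_eq_insert hs,
      if_neg (show ¬ (s.card = 1 ∧ True ∧ T = {toLex (s.max' hs, j)}) from fun h => h1 h.1), add_zero]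
    by_cases hT : T.erase (toLex (s.max' hs, j)) = ((s.erase (s.max' hs)) ×ˢ ({j} : Finset κ)).image toLex
    · rw [if_pos hT, if_pos ((Finset.erase_eq_iff_eq_insert hw (toLex_max'_not_mem_image_erase hs j)).mp hT)]
    · rw [if_neg hT, if_neg (fun h => hT ((Finset.erase_eq_iff_eq_insert hw (toLex_max'_not_mem_image_erase hs j)).mpr h))]

/-! ### §3 Sets containing the last column -/

/-- **Peeling the last column**: if `{max s} × t ⊆ T` and `#t ≥ 2`, the horizontal branch of the last-vertex recursion vanishes (the
vertex `(max s, j)`, `j ≠ max t`, survives in `T ∖ w₁` but not in the column-shortened rectangle), so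
`m(s, t, T) = m(s, t ∖ max t, T ∖ (max s, max t))`. [cite: EilenbergMacLane1953, §5] -/
theorem shuffleCoeff_of_column {s : Finset ι} {t : Finset κ} (hs : s.Nonempty) (ht : t.Nonempty) (h2 : 2 ≤ t.card)
    {T : Finset (ι ×ₗ κ)} (hS : ∀ j ∈ t, toLex (s.max' hs, j) ∈ T) :
    shuffleCoeff s t T = shuffleCoeff s (t.erase (t.max' ht)) (T.erase (toLex (s.max' hs, t.max' ht))) := by
  rw [shuffleCoeff_unfold hs ht (hS _ (t.max'_mem ht)), if_neg (fun h => by omega), add_zero]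
  -- the vertex `(max s, min t)` lies in `T ∖ w₁`, in column `max s`
  have hne : t.min' ht ≠ t.max' ht := ne_of_lt (Finset.min'_lt_max'_of_card t h2)
  have hmem : toLex (s.max' hs, t.min' ht) ∈ T.erase (toLex (s.max' hs, t.max' ht)) := by
    exact Finset.mem_erase.mpr ⟨fun h => hne (congrArg (fun w => (ofLex w).2) h), hS _ (t.min'_mem ht)⟩
  rw [shuffleCoeff_erase_left_eq_zero_of_mem hmem (show (ofLex (toLex (s.max' hs, t.min' ht))).1 = s.max' hs from rfl),
    mul_zero, zero_add]

/-- The minimum survives the removal of the maximum when `#t ≥ 2`. [folklore] -/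
private theorem min'_erase_max' {t : Finset κ} (ht : t.Nonempty) (h2 : 2 ≤ t.card) (ht' : (t.erase (t.max' ht)).Nonempty) :
    (t.erase (t.max' ht)).min' ht' = t.min' ht := by
  have hne : t.min' ht ≠ t.max' ht := ne_of_lt (Finset.min'_lt_max'_of_card t h2)
  refine le_antisymm (Finset.min'_le _ _ (Finset.mem_erase.mpr ⟨hne, t.min'_mem ht⟩)) ?_
  exact Finset.le_min' _ _ _ fun y hy => Finset.min'_le _ _ (Finset.mem_of_mem_erase hy)

/-- The staircase grows by the last vertex: `stair(s, t) = (max s, max t) ∪ stair(s, t ∖ max t)` for `#t ≥ 2`.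
[cite: EilenbergMacLane1953, §5] -/
theorem staircase_eq_insert {s : Finset ι} {t : Finset κ} (hs : s.Nonempty) (ht : t.Nonempty) (h2 : 2 ≤ t.card)
    (ht' : (t.erase (t.max' ht)).Nonempty) :
    ((s ×ˢ ({t.min' ht} : Finset κ)) ∪ (({s.max' hs} : Finset ι) ×ˢ t)).image toLex =
      insert (toLex (s.max' hs, t.max' ht))
        (((s ×ˢ ({(t.erase (t.max' ht)).min' ht'} : Finset κ)) ∪
          (({s.max' hs} : Finset ι) ×ˢ (t.erase (t.max' ht)))).image toLex) := by
  rw [min'_erase_max' ht h2 ht']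
  ext w
  rw [Finset.mem_insert, mem_staircase, mem_staircase, Finset.mem_erase]
  constructor
  · rintro (h | ⟨h1, h2'⟩)
    · exact Or.inr (Or.inl h)
    · by_cases hj : (ofLex w).2 = t.max' ht
      · left
        apply ofLex.injective
        exact Prod.ext h1 hj
      · exact Or.inr (Or.inr ⟨h1, hj, h2'⟩)
  · rintro (rfl | h | ⟨h1, -, h2'⟩)
    · exact Or.inr ⟨rfl, t.max'_mem ht⟩
    · exact Or.inl h
    · exact Or.inr ⟨h1, h2'⟩

/-- The last vertex is not on the shorter staircase (`#t ≥ 2`). [cite: EilenbergMacLane1953, §5] -/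
theorem toLex_max'_not_mem_staircase_erase {s : Finset ι} {t : Finset κ} (hs : s.Nonempty) (ht : t.Nonempty)
    (h2 : 2 ≤ t.card) (ht' : (t.erase (t.max' ht)).Nonempty) :
    toLex (s.max' hs, t.max' ht) ∉
      ((s ×ˢ ({(t.erase (t.max' ht)).min' ht'} : Finset κ)) ∪
        (({s.max' hs} : Finset ι) ×ˢ (t.erase (t.max' ht)))).image toLex := by
  rw [min'_erase_max' ht h2 ht', mem_staircase]
  rintro (⟨-, h⟩ | ⟨-, h⟩)
  · exact (ne_of_lt (Finset.min'_lt_max'_of_card t h2)).symm h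
  · exact Finset.notMem_erase (t.max' ht) t h

/-- **Sets containing the last column carry the coefficient of the staircase only**: if `{max s} × t ⊆ T` then
`m(s, t, T) = [T = (s × {min t}) ∪ ({max s} × t)]` — peel the column down to one row (`shuffleCoeff_of_column`,
`shuffleCoeff_singleton_right`). [cite: EilenbergMacLane1953, §5] [cite: StacksProject, Tag 0BEC] -/
theorem shuffleCoeff_eq_ite_of_column {s : Finset ι} {t : Finset κ} (hs : s.Nonempty) (ht : t.Nonempty)
    {T : Finset (ι ×ₗ κ)} (hS : ∀ j ∈ t, toLex (s.max' hs, j) ∈ T) :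
    shuffleCoeff s t T =
      if T = ((s ×ˢ ({t.min' ht} : Finset κ)) ∪ (({s.max' hs} : Finset ι) ×ˢ t)).image toLex then 1 else 0 := by
  induction hn : t.card using Nat.strong_induction_on generalizing t T with
  | _ n ih =>
  by_cases h1 : t.card = 1
  · -- one row
    obtain ⟨j, rfl⟩ := Finset.card_eq_one.mp h1
    have hu : (s ×ˢ ({({j} : Finset κ).min' ht} : Finset κ)) ∪ (({s.max' hs} : Finset ι) ×ˢ ({j} : Finset κ)) =
        s ×ˢ ({j} : Finset κ) := by
      rw [Finset.min'_singleton]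
      exact Finset.union_eq_left.mpr (Finset.product_subset_product (Finset.singleton_subset_iff.mpr (s.max'_mem hs))
        subset_rfl)
    rw [hu]
    exact shuffleCoeff_singleton_right hs j T
  · have h2 : 2 ≤ t.card := by have := ht.card_pos; omega
    have ht' : (t.erase (t.max' ht)).Nonempty := by
      rw [← Finset.card_pos]; have := Finset.card_erase_add_one (t.max'_mem ht); omega
    have hlt : (t.erase (t.max' ht)).card < n := by
      have := Finset.card_erase_lt_of_mem (t.max'_mem ht); omega
    have hS' : ∀ j ∈ t.erase (t.max' ht), toLex (s.max' hs, j) ∈ T.erase (toLex (s.max' hs, t.max' ht)) := by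
      intro j hj
      exact Finset.mem_erase.mpr ⟨fun h => (Finset.mem_erase.mp hj).1 (congrArg (fun w => (ofLex w).2) h),
        hS _ (Finset.mem_of_mem_erase hj)⟩
    rw [shuffleCoeff_of_column hs ht h2 hS, ih _ hlt ht' hS' rfl, staircase_eq_insert hs ht h2 ht']
    have hw : toLex (s.max' hs, t.max' ht) ∈ T := hS _ (t.max'_mem ht)
    have key := Finset.erase_eq_iff_eq_insert hw (toLex_max'_not_mem_staircase_erase hs ht h2 ht')
    by_cases hT : T.erase (toLex (s.max' hs, t.max' ht)) =
        ((s ×ˢ ({(t.erase (t.max' ht)).min' ht'} : Finset κ)) ∪ (({s.max' hs} : Finset ι) ×ˢ (t.erase (t.max' ht)))).image toLex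
    · rw [if_pos hT, if_pos (key.mp hT)]
    · rw [if_neg hT, if_neg (fun h => hT (key.mpr h))]

end OrderedCech

end Literature.Algebra.Homology
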